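import Summits.BirchSwinnertonDyer.BirchSwinnertonDyer.Theorems.GoldfeldAllTwistsTwoConverseTwinHalfTraceSevenModEightAssembly
import Summits.BirchSwinnertonDyer.BirchSwinnertonDyer.Theorems.GoldfeldAllTwistsTwoConverseTwinGenusOddMultiple
import Literature.NumberTheory.EllipticCurves.KramerDescent
import HarnessLib

set_option linter.dupNamespace false
set_option autoImplicit false

/-!
# LINE B49, family F3, quarter `ℓ ≡ 3 (mod 8)`: the CORE of THEOREM A‴ — (a) the torsion branch of the half-trace
# bookkeeping («`y_K` torsion ⟹ an odd multiple of `y_K` is `T`»), (b) the `2`-isogeny DESCENT CLASS of a sum hitting `T`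

Cell `bsd-goldfeld`, seat `bsd-goldfeld-s1p-c3x` (prover, gen 3); planner g38 RULINGS (cxliv)/(cxlv), ORDER «A‴-F3|ℓ≡3(8)», file K12
of memo `HOME/F3-ETA-DESCENT.md` §8. Support for item `stmt-BirchSwinnertonDyer-19350` (`BSDTwoCMSplitRankOne`; no claim, no
closure). Theses-free, FACT-FREE, theorems only (0 def). Companion of gen 0's `…TwinHalfTraceSevenModEightCore.lean` (the
`ℓ ≡ 7 (mod 8)` quarter, THEOREM A″).

(a) THE TORSION BRANCH (§1 abstract, §2 on `X₀(49)(L)`): `T + T = 0`; a subgroup `B` whose torsion elements have ODD multiples in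
`{0, T}`; `y + P = 2Ψ`, `M•P = (2m)•Y + t` (`M` odd, `t` torsion, `Ψ, Y ∈ B`); an additive `κ` (= `τσ₁` in the application) with
`κΨ = Ψ − y + T`, `κY = Y`, `κT = T`. Then `y` torsion ⟹ `n•y = T` for an ODD `n`. [For `ℓ ≡ 7 (8)` one has `κΨ = Ψ − y` and the live
branch is `n•y = 0` — A″'s mod-4 ending; here the live branch `T` is killed by (b) + Deuring, memo §4.] `κΨ⁻ = Ψ⁻ − y + T` comes from
the half-trace laws `Ψ^± + τΨ^± = T` (`#Cl(−8ℓ)²` ODD, sibling K5), the coset swap `σ₁Ψ⁻ = Ψ⁺` and `y = Ψ⁺ + Ψ⁻` (§3).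
(b) THE DESCENT CLASS (§4): on the normal form `V : Y² = X(X² + 21X + 112)` of `X₀(49)` (`cm7NFChange`, `X = 4(x − 2)`, `T ↦ (0,0)`;
Ligozat 1975 p. 45) Silverman–Tate's `α = xSqClass` is a homomorphism (`xSqClass_add`) with `α(T) = [112] = [7]`, `α(P) = [x(P) − 2]`:
`Σᵢ Pᵢ = T` forces `7·∏ᵢ(x(Pᵢ) − 2) ∈ F^{×2}`; for a Galois orbit, `7·N_{L/K}(x(y) − 2) ∈ L^{×2}`. Print precedent of descent on
Heegner points through a modular unit: Gross 1987 (prime level); NOVELTY: level `49 = 7²`, unit `x − 2 = η(τ)/η(49τ)` (memo §2).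

HONEST FRAMING: group theory and `2`-descent algebra; nothing about Heegner points is proved in this file; F3 is a density-zero family;
item 19350 unchanged; BSD is not proved by any of this.

References: B. Gross, LMS LN 153 (1991) Prop. 5.3 [GrossLMS1991]; B. Gross, J. Math. Soc. Japan 39 (1987) [Gross1987JMSJ];
G. Ligozat, Mém. SMF 43 (1975) Prop. 5.1.1, p. 45 [Ligozat1975]; J. Silverman, J. Tate, *Rational Points on Elliptic Curves* (2015)
§3.5 [SilvermanTate2015]; J. Coates, Y. Li, Y. Tian, S. Zhai, PLMS 110 (2015) Thm. 2.2 [CoatesLiTianZhai2015].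
-/

noncomputable section

open scoped Classical

open WeierstrassCurve Literature.NumberTheory.EllipticCurves Literature.NumberTheory.EllipticCurves.ModularForms
open WeierstrassCurve.Affine (sqClass sqClass_mul sqClass_sq sqClass_eq_one_iff)

namespace Summit.BirchSwinnertonDyer.BirchSwinnertonDyer.Theorems.GoldfeldGoodTwists

/-! ## §1 The abstract torsion branch -/

section Abstract

variable {A : Type*} [AddCommGroup A]

/-- **The torsion branch, mod `4`, for `h_K/2` odd.** `T + T = 0`, `κ T = T`; every torsion element of the subgroup `B` has an odd
multiple in `{0, T}`; `Ψ, Y ∈ B`, `y + P = 2Ψ`, `M•P = (2m)•Y + t` with `M` odd and `t` torsion; `κΨ = Ψ − y + T`, `κY = Y`.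
If `y` is torsion then `n • y = T` for some odd `n`. Proof: `u := MΨ − mY ∈ B` has `2u = My + t` torsion, so `n₁u ∈ {0, T}` is
`κ`-fixed for an odd `n₁`, while `κu = u − My + T`; hence `(n₁M)•y = T`. [cite: GrossLMS1991, Prop. 5.3 (shape of κΨ)] -/
theorem exists_odd_zsmul_eq_of_halfTrace_threeModEight (κ : A →+ A) (B : AddSubgroup A) {T y P Ψ Y t : A} {M m : ℤ}
    (hT2 : T + T = 0) (hκT : κ T = T)
    (htors : ∀ v ∈ B, IsOfFinAddOrder v → ∃ n : ℕ, Odd n ∧ (n • v = 0 ∨ n • v = T))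
    (hΨB : Ψ ∈ B) (hYB : Y ∈ B) (h1 : y + P = (2 : ℤ) • Ψ) (hκΨ : κ Ψ = Ψ - y + T) (hκY : κ Y = Y)
    (hM : Odd M) (ht : IsOfFinAddOrder t) (h4 : M • P = (2 * m) • Y + t) (hy : IsOfFinAddOrder y) :
    ∃ n : ℤ, Odd n ∧ n • y = T := by
  set u : A := M • Ψ - m • Y with hu_def
  have huB : u ∈ B := sub_mem (B.zsmul_mem hΨB M) (B.zsmul_mem hYB m)
  -- `2u = My + t`
  have h2u : (2 : ℤ) • u = M • y + t := by
    have e1 : (2 : ℤ) • (M • Ψ) = M • (y + P) := by rw [h1, smul_smul, smul_smul, mul_comm]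
    have e2 : (2 : ℤ) • (m • Y) = (2 * m) • Y := by rw [smul_smul]
    rw [hu_def, smul_sub, e1, e2, smul_add, h4]
    abel
  have hufin : IsOfFinAddOrder u := by
    have h2 : IsOfFinAddOrder ((2 : ℤ) • u) := by
      rw [h2u, ← AddCommGroup.mem_torsion]
      exact add_mem (AddSubgroup.zsmul_mem _ ((AddCommGroup.mem_torsion _).mpr hy) M) ((AddCommGroup.mem_torsion _).mpr ht)
    obtain ⟨k, hk, hku⟩ := (isOfFinAddOrder_iff_zsmul_eq_zero).mp h2
    exact (isOfFinAddOrder_iff_zsmul_eq_zero).mpr ⟨k * 2, mul_ne_zero hk two_ne_zero, by rw [mul_smul, hku]⟩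
  -- an odd multiple of `u` lies in `{0, T}`, hence is fixed by `κ`
  obtain ⟨n₁, hn₁, hfix⟩ := htors u huB hufin
  have hn₁' : Odd (n₁ : ℤ) := by exact_mod_cast hn₁
  have hMT : M • T = T := zsmul_eq_self_of_odd_of_add_self_eq_zero hT2 hM
  have hnT : (n₁ : ℤ) • T = T := zsmul_eq_self_of_odd_of_add_self_eq_zero hT2 hn₁'
  have hκu : κ u = u - M • y + T := by
    rw [hu_def, map_sub, map_zsmul, map_zsmul, hκΨ, hκY, smul_add, smul_sub, hMT]
    abel
  have hκfix : κ ((n₁ : ℤ) • u) = (n₁ : ℤ) • u := by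
    rw [natCast_zsmul]
    rcases hfix with h0 | hT
    · rw [h0, map_zero]
    · rw [hT, hκT]
  -- compare: `n₁u = κ(n₁u) = n₁u − (n₁M)y + T`
  have key : (n₁ : ℤ) • u + 0 = (n₁ : ℤ) • u + (T - (n₁ * M : ℤ) • y) := by
    have e : κ ((n₁ : ℤ) • u) = (n₁ : ℤ) • u - (n₁ * M : ℤ) • y + T := by
      rw [map_zsmul, hκu, smul_add, smul_sub, smul_smul, hnT]
    rw [hκfix] at e
    rw [add_zero]
    conv_lhs => rw [e]
    abel
  refine ⟨n₁ * M, hn₁'.mul hM, ?_⟩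
  have h0 : (0 : A) = T - (n₁ * M : ℤ) • y := add_left_cancel key
  exact (sub_eq_zero.mp h0.symm).symm

end Abstract

/-! ## §2 The torsion branch on `X₀(49)(L)` relative to the points coming from a field `F` (`−7, 7 ∉ F²`) -/

section Interface

variable {F L : Type*} [Field F] [CharZero F] [Field L] [CharZero L]

/-- **The torsion branch on `X₀(49)(L)`** (the interface the assembly instantiates with `F = K(√−ℓ)`, `L = K[1]`): `F → L` fields of
characteristic `0` with `−7, 7 ∉ F²` (so every torsion point coming from `X₀(49)(F)` has an odd multiple in `{O, T}`, gen 0's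
`cm7_exists_odd_nsmul_mem_pair_of_mem_range`), `κ` an additive self-map of `X₀(49)(L)` fixing `T = (2, −1)`, `Ψ, Y` coming from
`X₀(49)(F)`, `y + P = 2Ψ`, `M•P = (2m)•Y + t` (`M` odd, `t` torsion), `κΨ = Ψ − y + T`, `κY = Y`. If `y` is torsion then
`n • y = T` for an odd `n`. [cite: GrossLMS1991, Prop. 5.3] [cite: SilvermanTate2015, §3.5] -/
theorem exists_odd_zsmul_eq_twoTorsion_of_halfTrace_threeModEight_cm7 (f : F →+* L) (h7 : ¬ IsSquare (-7 : F))
    (h7' : ¬ IsSquare (7 : F)) (κ : (cm7.baseChange L).toAffine.Point →+ (cm7.baseChange L).toAffine.Point)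
    (hκT : κ (Affine.Point.some 2 (-1) (nonsingular_cm7_baseChange_two_neg_one L)) =
      Affine.Point.some 2 (-1) (nonsingular_cm7_baseChange_two_neg_one L))
    {y P Ψ Y t : (cm7.baseChange L).toAffine.Point} {M m : ℤ}
    (hΨF : Ψ ∈ (Affine.Point.map (W' := cm7) f.toRatAlgHom).range)
    (hYF : Y ∈ (Affine.Point.map (W' := cm7) f.toRatAlgHom).range)
    (h1 : y + P = (2 : ℤ) • Ψ)
    (hκΨ : κ Ψ = Ψ - y + Affine.Point.some 2 (-1) (nonsingular_cm7_baseChange_two_neg_one L)) (hκY : κ Y = Y)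
    (hM : Odd M) (ht : IsOfFinAddOrder t) (h4 : M • P = (2 * m) • Y + t) (hy : IsOfFinAddOrder y) :
    ∃ n : ℤ, Odd n ∧ n • y = Affine.Point.some 2 (-1) (nonsingular_cm7_baseChange_two_neg_one L) :=
  exists_odd_zsmul_eq_of_halfTrace_threeModEight κ _ (cm7_twoTorsion_add_self L) hκT
    (cm7_exists_odd_nsmul_mem_pair_of_mem_range f h7 h7') hΨF hYF h1 hκΨ hκY hM ht h4 hy

end Interface

/-! ## §3 Galois bookkeeping: the coset swap `σ₁Ψ⁻ = Ψ⁺` and the splitting `y = Ψ⁺ + Ψ⁻` -/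

section Swap

variable {k : Type*} {L : Type*} [Field k] [CharZero k] [Field L] [CharZero L] [Algebra k L]
  (W : WeierstrassCurve ℚ)

/-- **Coset swap.** For `r₀² = d ∈ k`, `r₀ ≠ 0`, and `τ ∈ Gal(L/k)` with `τ r₀ = −r₀`: `τ` maps the weighted sum with weights
`(a on σ r₀ = r₀, b otherwise)` to the one with weights `(b, a)` — left multiplication by `τ` swaps the two cosets of the stabiliser of
`r₀`. [cite: Gross1984, §4] -/
theorem map_indicatorSum_eq_swap_of_apply_eq_neg [FiniteDimensional k L] (τ : L ≃ₐ[k] L) {r₀ : L} {d : k}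
    (hr : r₀ ^ 2 = algebraMap k L d) (hr0 : r₀ ≠ 0) (h2 : (2 : L) ≠ 0) (hτ : τ r₀ = -r₀)
    (y : (W.baseChange L).toAffine.Point) (a b : ℤ) :
    WeierstrassCurve.Affine.Point.map (τ : L →ₐ[k] L)
        (∑ σ : L ≃ₐ[k] L, (if σ r₀ = r₀ then a else b) • WeierstrassCurve.Affine.Point.map (σ : L →ₐ[k] L) y) =
      ∑ σ : L ≃ₐ[k] L, (if σ r₀ = r₀ then b else a) • WeierstrassCurve.Affine.Point.map (σ : L →ₐ[k] L) y := by
  rw [map_sum]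
  simp_rw [map_zsmul, WeierstrassCurve.Affine.Point.map_map]
  have h : ∀ σ : L ≃ₐ[k] L, ((τ : L →ₐ[k] L).comp (σ : L →ₐ[k] L)) = ((τ * σ : L ≃ₐ[k] L) : L →ₐ[k] L) :=
    fun σ => rfl
  simp_rw [h]
  have hε : ∀ σ : L ≃ₐ[k] L, (if σ r₀ = r₀ then a else b) = (if (τ * σ) r₀ = r₀ then b else a) := by
    intro σ
    rw [mul_apply_sqrt_eq_iff_of_neg τ σ hr hr0 h2 hτ]
    by_cases hs : σ r₀ = r₀ <;> simp [hs]
  calc ∑ σ : L ≃ₐ[k] L, (if σ r₀ = r₀ then a else b) •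
        WeierstrassCurve.Affine.Point.map ((τ * σ : L ≃ₐ[k] L) : L →ₐ[k] L) y
      = ∑ σ : L ≃ₐ[k] L, (if (τ * σ) r₀ = r₀ then b else a) •
        WeierstrassCurve.Affine.Point.map ((τ * σ : L ≃ₐ[k] L) : L →ₐ[k] L) y :=
        Finset.sum_congr rfl fun σ _ => by rw [hε σ]
    _ = ∑ σ : L ≃ₐ[k] L, (if σ r₀ = r₀ then b else a) • WeierstrassCurve.Affine.Point.map (σ : L →ₐ[k] L) y :=
        Fintype.sum_equiv (Equiv.mulLeft τ) _ _ fun _ => rfl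

/-- **Splitting of the trace**: `Σ_σ σy = Ψ⁺ + Ψ⁻` with `Ψ⁺ = Σ_{σ r₀ = r₀} σy`, `Ψ⁻ = Σ_{σ r₀ ≠ r₀} σy` (indicator weights
`(1,0)` and `(0,1)`). [folklore] -/
theorem sum_map_eq_indicatorSum_add_indicatorSum [FiniteDimensional k L] (r₀ : L) (y : (W.baseChange L).toAffine.Point) :
    ∑ σ : L ≃ₐ[k] L, WeierstrassCurve.Affine.Point.map (σ : L →ₐ[k] L) y =
      ∑ σ : L ≃ₐ[k] L, (if σ r₀ = r₀ then (1 : ℤ) else 0) • WeierstrassCurve.Affine.Point.map (σ : L →ₐ[k] L) y +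
        ∑ σ : L ≃ₐ[k] L, (if σ r₀ = r₀ then (0 : ℤ) else 1) • WeierstrassCurve.Affine.Point.map (σ : L →ₐ[k] L) y := by
  rw [← Finset.sum_add_distrib]
  refine Finset.sum_congr rfl fun σ _ => ?_
  by_cases h : σ r₀ = r₀
  · rw [if_pos h, if_pos h, one_zsmul, zero_zsmul, add_zero]
  · rw [if_neg h, if_neg h, one_zsmul, zero_zsmul, zero_add]

end Swap

/-! ## §4 The `2`-isogeny descent class of a sum hitting `T` -/

section DescentClass

variable {F : Type*} [Field F] [CharZero F]

/-- The `X`-coordinate of `cm7NFChange`: `x ↦ 4(x − 2)` (`u = 1/2`, `r = 2`). [cite: SilvermanAEC2009, III.1 Table 3.1] -/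
theorem cm7NFChange_toX (x : F) : (cm7NFChange F).toX x = 4 * (x - 2) := by
  simp [VariableChange.toX_def, cm7NFChange]; norm_num

/-- **The descent class of a sum hitting `T`.** Let `Pᵢ = (xᵢ, yᵢ)` (`i ∈ s`) be affine points of `X₀(49)` over a field `F`
of characteristic `0` with `xᵢ ≠ 2` (i.e. `Pᵢ ≠ T`), and suppose `Σ_{i ∈ s} Pᵢ = T = (2, −1)`. Then `7 · ∏_{i ∈ s} (xᵢ − 2)` is a
square in `F`. (Transport to `V = y² = x³ + 21x² + 112x` by `cm7NFChange`, where `α = xSqClass` is a homomorphism with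
`α(T) = [112] = [7]` and `α(Pᵢ) = [4(xᵢ − 2)] = [xᵢ − 2]`.) [cite: SilvermanTate2015, §3.5] -/
theorem isSquare_seven_mul_prod_of_sum_eq_twoTorsion {ι : Type*} (s : Finset ι) {x y : ι → F}
    (h : ∀ i, (cm7.baseChange F).toAffine.Nonsingular (x i) (y i)) (hx : ∀ i ∈ s, x i ≠ 2)
    (hsum : ∑ i ∈ s, Affine.Point.some (x i) (y i) (h i) =
      Affine.Point.some 2 (-1) (nonsingular_cm7_baseChange_two_neg_one F)) :
    IsSquare (7 * ∏ i ∈ s, (x i - 2)) := by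
  set V : WeierstrassCurve F := cm7NFChange F • cm7.baseChange F with hV
  have hVeq : V = ⟨0, 21, 0, 112, 0⟩ := cm7NFChange_smul
  haveI : V.IsTwoTorsionNF := by rw [hVeq]; infer_instance
  have ha₄ : V.a₄ = 112 := by rw [hVeq]
  let e : (cm7.baseChange F).toAffine.Point ≃+ V.toAffine.Point :=
    VariableChange.pointEquiv (cm7.baseChange F) (cm7NFChange F)
  -- `α ∘ e` is multiplicative over finite sums
  have hmul : ∀ t : Finset ι, V.xSqClass (e (∑ i ∈ t, Affine.Point.some (x i) (y i) (h i))) =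
      ∏ i ∈ t, V.xSqClass (e (Affine.Point.some (x i) (y i) (h i))) := by
    intro t
    induction t using Finset.induction_on with
    | empty => rw [Finset.sum_empty, Finset.prod_empty, map_zero, xSqClass_zero]
    | insert a t ha ih => rw [Finset.sum_insert ha, Finset.prod_insert ha, map_add, xSqClass_add, ih]
  -- the value on each `Pᵢ`
  have hpt : ∀ i ∈ s, V.xSqClass (e (Affine.Point.some (x i) (y i) (h i))) = sqClass (x i - 2) := by
    intro i hi
    have hxi : x i - 2 ≠ 0 := sub_ne_zero.mpr (hx i hi)
    have hg' := (VariableChange.nonsingular_iff (cm7.baseChange F) (cm7NFChange F) (x i) (y i)).mpr (h i)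
    have he : e (Affine.Point.some (x i) (y i) (h i)) =
        .some ((cm7NFChange F).toX (x i)) ((cm7NFChange F).toY (x i) (y i)) hg' :=
      VariableChange.pointEquiv_some _ _ (h i)
    have hx0 : (cm7NFChange F).toX (x i) ≠ 0 := by
      rw [cm7NFChange_toX]; exact mul_ne_zero (by norm_num) hxi
    rw [he, xSqClass_some_of_ne_zero hg' hx0, cm7NFChange_toX, sqClass_mul (by norm_num) hxi,
      show (4 : F) = 2 ^ 2 by norm_num, sqClass_sq, Affine.SqUnits.one_mul]
  -- the value on `T`
  have hT : V.xSqClass (e (Affine.Point.some 2 (-1) (nonsingular_cm7_baseChange_two_neg_one F))) =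
      sqClass (7 : F) := by
    have hg' := (VariableChange.nonsingular_iff (cm7.baseChange F) (cm7NFChange F) 2 (-1)).mpr
      (nonsingular_cm7_baseChange_two_neg_one F)
    have he : e (Affine.Point.some 2 (-1) (nonsingular_cm7_baseChange_two_neg_one F)) =
        .some ((cm7NFChange F).toX 2) ((cm7NFChange F).toY 2 (-1)) hg' :=
      VariableChange.pointEquiv_some _ _ _
    have hx0 : (cm7NFChange F).toX 2 = 0 := by rw [cm7NFChange_toX]; ring
    rw [he, xSqClass_some_of_eq_zero hg' hx0, ha₄, show (112 : F) = 7 * 4 ^ 2 by norm_num,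
      sqClass_mul (by norm_num) (by norm_num), sqClass_sq, Affine.SqUnits.mul_one]
  -- combine: `[7] = ∏ [xᵢ − 2] = [∏ (xᵢ − 2)]`
  have hne : ∏ i ∈ s, (x i - 2) ≠ 0 :=
    Finset.prod_ne_zero_iff.mpr fun i hi => sub_ne_zero.mpr (hx i hi)
  have key : sqClass (7 : F) = sqClass (∏ i ∈ s, (x i - 2)) := by
    rw [← hT, ← hsum, hmul, sqClass_finset_prod s _ fun i hi => sub_ne_zero.mpr (hx i hi)]
    exact Finset.prod_congr rfl hpt
  have h1 : sqClass (7 * ∏ i ∈ s, (x i - 2)) = 1 := by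
    rw [sqClass_mul (by norm_num) hne, key, Affine.SqUnits.mul_self]
  obtain ⟨u, hu⟩ := (sqClass_eq_one_iff (mul_ne_zero (by norm_num) hne)).mp h1
  exact ⟨u, by rw [hu, pow_two]⟩

/-- **Odd rescaling.** If `Σ_{i ∈ s} Pᵢ = n • T` with `n` ODD (so `n • T = T`), the same conclusion holds — the form in which
the Heegner bookkeeping delivers the torsion branch (`∃ n odd, n • y_K = T`, applied to the conjugates of `n • y₁`… here simply
`n • T = T`). [cite: SilvermanTate2015, §3.5] -/
theorem isSquare_seven_mul_prod_of_sum_eq_odd_zsmul_twoTorsion {ι : Type*} (s : Finset ι) {x y : ι → F}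
    (h : ∀ i, (cm7.baseChange F).toAffine.Nonsingular (x i) (y i)) (hx : ∀ i ∈ s, x i ≠ 2) {n : ℤ} (hn : Odd n)
    (hsum : ∑ i ∈ s, Affine.Point.some (x i) (y i) (h i) =
      n • Affine.Point.some 2 (-1) (nonsingular_cm7_baseChange_two_neg_one F)) :
    IsSquare (7 * ∏ i ∈ s, (x i - 2)) := by
  rw [zsmul_eq_self_of_odd_of_add_self_eq_zero (cm7_twoTorsion_add_self (F := F)) hn] at hsum
  exact isSquare_seven_mul_prod_of_sum_eq_twoTorsion s h hx hsum

end DescentClass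

section Galois

variable {K L : Type*} [Field K] [CharZero K] [Field L] [CharZero L] [Algebra K L] [FiniteDimensional K L]
  [IsGalois K L]

/-- **Galois-orbit form.** `L/K` finite Galois of characteristic `0`, `y = (x₀, y₀) ∈ X₀(49)(L)` affine with `x₀ ≠ 2`; if the
Galois trace `Σ_{σ ∈ Gal(L/K)} σ(y)` equals `n • T` with `n` odd, then `7 · N_{L/K}(x₀ − 2)` is a square in `L` (the norm taken in
`L` via `algebraMap K L`). The conjugates `σ(y) = (σx₀, σy₀)` all have `σx₀ ≠ 2`, and `∏_σ (σx₀ − 2) = N_{L/K}(x₀ − 2)`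
(Mathlib `Algebra.norm_eq_prod_automorphisms`). [cite: SilvermanTate2015, §3.5] -/
theorem isSquare_seven_mul_norm_of_trace_eq_odd_zsmul_twoTorsion {x₀ y₀ : L}
    (h₀ : (cm7.baseChange L).toAffine.Nonsingular x₀ y₀) (hx₀ : x₀ ≠ 2) {n : ℤ} (hn : Odd n)
    (htr : ∑ σ : L ≃ₐ[K] L, Affine.Point.map (σ : L →ₐ[K] L) (Affine.Point.some x₀ y₀ h₀) =
      n • Affine.Point.some 2 (-1) (nonsingular_cm7_baseChange_two_neg_one L)) :
    IsSquare (7 * algebraMap K L (Algebra.norm K (x₀ - 2))) := by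
  have hmap : ∀ σ : L ≃ₐ[K] L, ∃ hσ, Affine.Point.map (σ : L →ₐ[K] L) (Affine.Point.some x₀ y₀ h₀) =
      Affine.Point.some (σ x₀) (σ y₀) hσ := fun σ ↦ ⟨_, Affine.Point.map_some _ _⟩
  choose hσ hmapσ using hmap
  have hx : ∀ σ ∈ (Finset.univ : Finset (L ≃ₐ[K] L)), σ x₀ ≠ 2 := by
    intro σ _ hσ2
    apply hx₀
    have : σ x₀ = σ 2 := by rw [hσ2, map_ofNat]
    exact σ.injective this
  have hsum : ∑ σ ∈ (Finset.univ : Finset (L ≃ₐ[K] L)), Affine.Point.some (σ x₀) (σ y₀) (hσ σ) =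
      n • Affine.Point.some 2 (-1) (nonsingular_cm7_baseChange_two_neg_one L) := by
    rw [← htr]
    exact Finset.sum_congr rfl fun σ _ ↦ (hmapσ σ).symm
  have hsq := isSquare_seven_mul_prod_of_sum_eq_odd_zsmul_twoTorsion Finset.univ (fun σ ↦ hσ σ) hx hn hsum
  have hnorm : algebraMap K L (Algebra.norm K (x₀ - 2)) = ∏ σ : L ≃ₐ[K] L, (σ x₀ - 2) := by
    rw [Algebra.norm_eq_prod_automorphisms]
    exact Finset.prod_congr rfl fun σ _ ↦ by rw [map_sub, map_ofNat]
  rwa [hnorm]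

end Galois


end Summit.BirchSwinnertonDyer.BirchSwinnertonDyer.Theorems.GoldfeldGoodTwists

end
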